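import Literature.MathematicalPhysics.QuantumFieldTheory.Dimock2011to13.BoundaryTermLedger

/-!
# Dimock, *The renormalization group according to Balaban* II, §3.18 Lemma 3.22 (lulu): the TINY-TERM LEDGER
`|R_{k+1}(X)| ≤ λ_{k+1}^{n₀} e^{−κ d_M(X)}` — six pieces at `⅙` each, the OLD ones by the coupling-RATIO device, the
NEW ones by the extent factor `e^{−r_{k+1}}` and one extra power of the coupling — PROVED as model-free arithmetic
with every smallness clause explicit and `k`-free (companion of `BoundaryTermLedger`)

**Citation header (reproduction of PUBLISHED work; template of the Balaban lattice Yang–Mills cell).**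
J. Dimock, *The renormalization group according to Balaban. II. Large fields*, J. Math. Phys. **54** (2013) 092301
(= arXiv:1212.5562v2) [Dimock2013BalabanII], §3.17 TeX L6017–6021 and §3.18 Lemma 3.22 \label{lulu} with its proof,
TeX L6054–6276 (TeX source held by the cell, `inputs/files/dimock/src/1212.5562/1212.5562.tex`, sha256[:16]
75c5792fc48eacbc; arXiv subsection and `[section]`-counter lemma numbering).

**What the paper prints (verbatim).**  L6017–6021: *"Now collect the tiny terms defining R^{*,(0)}_{k+1,π⁺} =
[(R^#_k)_{L^{−1}}]_{π⁺}(Λ_{k+1}) and R^*_{k+1,π⁺} = R^{*,(0)}_{k+1,π⁺} + … + R^{*,(5)}_{k+1,π⁺}"* (SIX parts); Lemma 3.22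
(lulu) L6066: *"|R_{k+1,π⁺}(X)| ≤ λ_{k+1}^{n₀} e^{−κd_M(X)}"*; L6075: *"R_{k+1,π⁺} has many pieces, which we consider
individually."*; the OLD piece, L6107: *"|(R^{*(0)}_{k+1,π⁺})′(Z)| ≤ 𝒪(1)L³λ_k^{n₀} e^{−L(κ−8κ₀−8)d_M(Z)}"* and L6112–6119:
*"We assume that κ is sufficiently large such that L(κ−8κ₀−8) ≥ κ. (It suffices for example that κ ≥ 16κ₀+16). Then
the exponent is dominated by e^{−κd_M(Z)}. Furthermore for L sufficiently large and n₀ ≥ 4  𝒪(1)L³λ_k^{n₀} =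
𝒪(1)L^{3−n₀}λ_{k+1}^{n₀} ≤ ⅙λ_{k+1}^{n₀}  This is why we chose n₀ ≥ 4. This is the basic mechanism which keeps the tiny
terms tiny, in spite of the growth factor L³. Thus the bound is |(R^{*(0)}_{k+1,π⁺})′(Z)| ≤ ⅙λ_{k+1}^{n₀}e^{−κd_M(Z)}"*;
the NEW pieces, L6149–6151: *"Then |δφ| ≤ Cλ_{k+1}^{−¼−2δ}e^{−r_{k+1}} on Λ_{k+1}. This follows since G_{k+1,Ω(Λ^*_{k+1})}
and G_{k+1,Ω′} have random walk expansions which only differ outside Λ^*_{k+1} which is [r_{k+1}] steps away from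
Λ_{k+1}."*, (noisette) L6161–6165: *"|R^{*,(1)}_{k+1,π⁺}(□)| ≤ CM³λ_{k+1}^{−½−4δ}e^{−r_{k+1}} ≤ λ_{k+1}^{n₀+1}"*,
L6223–6226: *"|(R^{*(1)}_{k+1,π⁺})″(Z)| ≤ 𝒪(1)λ_{k+1}^{n₀+1}e^{−2κd_M(Z)}"*, L6228–6233: *"Now split the terms into a
contribution to R_{k+1,π⁺}(X) and B^{*,(R)}_{k+1,π⁺}(X) as in the previous case. For the terms R_{k+1,π⁺}(X) we use
𝒪(1)λ_{k+1}^{n₀+1}e^{−2κd_M(X)} ≤ λ_{k+1}^{n₀}e^{−κd_M(X)}"*, L6252 (R^{*(2)}, R^{*(3)}): *"which shows these are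
tiny. Then proceed with the localization and split as before."*, L6257–6259: *"The term R^{*(4)}_{k+1,π⁺} is treated
like R^{*(1)}_{k+1,π⁺}, and R^{*(5)}_{k+1,π⁺} is treated like R^{*(2)}_{k+1,π⁺}."*

**What is reproduced here (kernel-checked, zero `sorry`).**
* Part 1 — the OLD piece (0): `old_tiny_sixth` = L6107 → L6119 assembled from `BoundaryTermLedger.tiny_term_sixth`
  (the coupling-RATIO device `𝒪(1)L³λ_k^{n₀} = 𝒪(1)L^{3−n₀}λ_{k+1}^{n₀} ≤ ⅙λ_{k+1}^{n₀}`, *"L sufficiently large"*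
  explicit as `6C₀ ≤ L^{n₀−3}`) and the rate clause `κ ≤ L(κ−8κ₀−8)`.
* Part 2 — the NEW pieces: **`new_tiny_extraction`** = (noisette) with *"λ sufficiently small"* EXPLICIT and `k`-FREE:
  for `r ≥ 2`, `−log λ ≥ max(1, n₀ + 2)` and `K λ^{1−a} ≤ 1` (`a = ½ + 4δ < 1`, `K = CM³`; `K_small_of_le`: holds once
  `λ ≤ K^{−1/(1−a)}`): `K λ^{−a} e^{−r(λ)} ≤ λ^{n₀+1}` — via `BoundaryTermLedger.exp_neg_rsep_le_rpow` (L4962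
  *"e^{−r_{k+1}} = 𝒪(λ_k^n) for any n"*, which needs `r ≥ 2`); the threshold depends on `M` — Theorem 3.1's *"λ_k
  sufficiently small (depending on L, M)"*; **`new_tiny_sixth`** = L6231–6233 with the fraction the print leaves
  implicit: `C′λ^{n₀+1}e^{−2κd} ≤ ⅙λ^{n₀}e^{−κd}` once `6C′λ ≤ 1`, `κ, d ≥ 0`.
* Part 3 — the assembly **`R_reproduced`**: six abstract pieces, `|r₀| ≤ C₀L³λ_k^{n₀}e^{−L(κ−8κ₀−8)d}` (L6107) and
  `|r_i| ≤ C_iλ_{k+1}^{n₀+1}e^{−2κd}`, `i = 1, …, 5` (L6224 for (1); (2)–(5) *"as before"* / *"treated like"*, a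
  reading), under the `k`-free clauses `6C₀ ≤ L^{n₀−3}`, `κ ≤ L(κ−8κ₀−8)`, `0 ≤ κ`, `6C_iλ_{k+1} ≤ 1` ⇒ `|r₀ + ⋯ + r₅|
  ≤ λ_{k+1}^{n₀}e^{−κd}` — (lulu)'s first line with NO constant in front, reproduced at every step; `why_one_sixth`:
  the `⅙` of L6116/L6119 is `1/(number of parts of R^* in L6020)`.  PRECISION (v1.1, XREAD C-adv4-125 I1): for
  pieces (4),(5) the print adds, L6261–6270, *"A difference is that these terms are initially localized in δΛ_k =
  Λ_k − Λ_{k+1}. In this domain δφ … satisfies |δφ| ≤ 𝒪(1)e^{−r_{k+1}}"* and *"If Z ∩ Λ_{k+1} = ∅ then … one can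
  deduce (R^{*(5)}_{k+1,π⁺})′(Z) = 0. Thus we can restrict to Z ∩ Λ_{k+1} ≠ ∅ and hence Z # Λ_{k+1}. All these
  terms contribute to B^{*,(R)}_{k+1,π⁺}(X)"* — so, as printed, pieces (4),(5) feed the B^{*,(R)} half (the `hbR` of
  `BoundaryTermLedger`), NOT the R_{k+1}(X) sum of (lulu)'s first line; in `R_reproduced` their hypotheses `h₄, h₅`
  then hold VACUOUSLY (`r₄ = r₅ = 0`, `C₄ = C₅ = 0`) and the theorem is a conservative SUPERSET of the printed
  R-ledger — **`R_half_as_printed`** records the printed case (pieces (0)–(3) only; `⅙` is then sufficient, `4·⅙ ≤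
  1`, not necessary).

**What is NOT claimed.**  Nothing of the model (the per-piece analytic bounds, the random-walk estimate of δφ, the
localization losses are HYPOTHESES); nothing about B^{*,(R)} beyond `BoundaryTermLedger` (its `hbR`) — in particular
the B^{*,(R)} contributions of pieces (4),(5) (L6268–6270) are NOT tracked here; the reading of pieces (2)–(5) in the
shape of (1) is marked as a reading ((2),(3): L6252 *"these are tiny … split as before"*; (4),(5): only through the
δΛ_k localization of L6261–6270, i.e. vacuously in the R-half).  TEMPLATE-SIDE USE (cell TEMPLATE.md §14.2b row 20, T-G6,
G-B14s-21: *"(2.44) for 𝐑^{(j)} «in an almost identical way»"*, template entry *"none for R-terms; shape-analog: D2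
§3.18 Lemma 3.22 (lulu)"*): the shape-analog typed — the OLD tiny terms need the ratio power (superrenormalizability),
the NEW ones need the separation scale `r_{k+1}` (with `r ≥ 2`) and one spare power of the coupling.  Dimock's papers
are the cell's TEMPLATE, published and refereed.  Value = bookkeeping; NOT summit progress.

Cell records: TEMPLATE.md §4.2 row «D2 §3.17–3.18», §14.2b row 20; unit `b2b-balaban-template` gen 26 (v1), gen 27
(v1.1 = XREAD C-adv4-125 fold: docstrings + `R_half_as_printed`; v1 declarations byte-identical).  NEW leaf; imports
`Dimock2011to13.BoundaryTermLedger` only; modifies nothing.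
-/

noncomputable section

open Real
open Literature.MathematicalPhysics.QuantumFieldTheory.Dimock2011to13.BoundaryTermLedger
  (rsep exp_neg_rsep_le_rpow tiny_term_sixth exp_rate_mono)

namespace Literature.MathematicalPhysics.QuantumFieldTheory.Dimock2011to13.TinyTermLedger

/-! ## Part 1. The OLD piece R^{*(0)}: the coupling-ratio device -/

/-- **THE OLD TINY TERMS** — [Dimock2013BalabanII] §3.18, L6107 → L6119 assembled: `|r₀| ≤ C₀L³λ_k^{n₀}e^{−L(κ−8κ₀−8)d}`
with `λ_{k+1} = Lλ_k`, the rate clause `κ ≤ L(κ−8κ₀−8)` and *"L sufficiently large"* as `6C₀ ≤ L^{n₀−3}` give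
`|r₀| ≤ ⅙λ_{k+1}^{n₀}e^{−κd}` (verbatim: *"Thus the bound is |(R^{*(0)}_{k+1,π⁺})′(Z)| ≤ ⅙λ_{k+1}^{n₀}e^{−κd_M(Z)}"*).
[cite: Dimock2013BalabanII, §3.18 proof of Lemma 3.22 (arXiv:1212.5562v2 TeX L6107–6119)] -/
theorem old_tiny_sixth {r₀ C₀ L n₀ κ κ₀ d lamk lamk1 : ℝ} (hL : 0 < L) (hlamk : 0 < lamk) (hstep : lamk1 = L * lamk)
    (hd : 0 ≤ d) (hr₀ : |r₀| ≤ C₀ * L ^ 3 * lamk ^ n₀ * Real.exp (-(L * (κ - 8 * κ₀ - 8)) * d))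
    (hC₀ : 0 ≤ C₀) (hbig : 6 * C₀ ≤ L ^ (n₀ - 3)) (hrate : κ ≤ L * (κ - 8 * κ₀ - 8)) :
    |r₀| ≤ (1 / 6) * lamk1 ^ n₀ * Real.exp (-κ * d) := by
  have h1 : C₀ * L ^ 3 * lamk ^ n₀ ≤ (1 / 6) * lamk1 ^ n₀ := tiny_term_sixth hL hlamk hstep hbig
  have h2 : Real.exp (-(L * (κ - 8 * κ₀ - 8)) * d) ≤ Real.exp (-κ * d) := exp_rate_mono hd hrate
  have h0 : 0 ≤ C₀ * L ^ 3 * lamk ^ n₀ := by positivity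
  calc |r₀| ≤ C₀ * L ^ 3 * lamk ^ n₀ * Real.exp (-(L * (κ - 8 * κ₀ - 8)) * d) := hr₀
    _ ≤ (1 / 6) * lamk1 ^ n₀ * Real.exp (-κ * d) := mul_le_mul h1 h2 (Real.exp_pos _).le (by linarith)

/-! ## Part 2. The NEW pieces R^{*(1)}, …, R^{*(5)}: the extent factor `e^{−r_{k+1}}` and one spare coupling power -/

/-- *"λ sufficiently small"* for (noisette), EXPLICIT: for `K > 0`, `a < 1` and `0 < λ ≤ K^{−1/(1−a)}` one has
`Kλ^{1−a} ≤ 1`. [folklore] -/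
theorem K_small_of_le {K a lam : ℝ} (hK : 0 < K) (ha : a < 1) (hlam : 0 < lam) (hle : lam ≤ K ^ (-(1 / (1 - a)))) :
    K * lam ^ (1 - a) ≤ 1 := by
  have h1a : 0 < 1 - a := by linarith
  have h1 : lam ^ (1 - a) ≤ (K ^ (-(1 / (1 - a)))) ^ (1 - a) := Real.rpow_le_rpow hlam.le hle h1a.le
  rw [← Real.rpow_mul hK.le, show -(1 / (1 - a)) * (1 - a) = -1 by field_simp, Real.rpow_neg_one] at h1
  calc K * lam ^ (1 - a) ≤ K * K⁻¹ := mul_le_mul_of_nonneg_left h1 hK.le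
    _ = 1 := mul_inv_cancel₀ hK.ne'

/-- **(noisette), EXPLICIT AND `k`-FREE** — [Dimock2013BalabanII] §3.18, verbatim: *"|R^{*,(1)}_{k+1,π⁺}(□)| ≤ CM³
λ_{k+1}^{−½−4δ}e^{−r_{k+1}} ≤ λ_{k+1}^{n₀+1}"* — PROVED for `r ≥ 2`, any exponent `a` (`a = ½ + 4δ` in print), `0 < λ`,
`−log λ ≥ max(1, n₀ + 2)` and `Kλ^{1−a} ≤ 1` (`K = CM³`; for `a < 1` a smallness condition on `λ`, `K_small_of_le`):
`Kλ^{−a}e^{−r(λ)} ≤ λ^{n₀+1}`.  The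
threshold involves `M` through `K` — Theorem 3.1's *"λ_k sufficiently small (depending on L, M)"* (L2389) — and no
`k`. [cite: Dimock2013BalabanII, §3.18 proof of Lemma 3.22 (arXiv:1212.5562v2 TeX L6161–6165)] -/
theorem new_tiny_extraction {r : ℕ} (hr : 2 ≤ r) {K a n₀ lam : ℝ} (hK : 0 ≤ K) (hlam : 0 < lam)
    (h1 : 1 ≤ -Real.log lam) (hn : n₀ + 2 ≤ -Real.log lam) (hKs : K * lam ^ (1 - a) ≤ 1) :
    K * lam ^ (-a) * Real.exp (-rsep r lam) ≤ lam ^ (n₀ + 1) := by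
  have hexp : Real.exp (-rsep r lam) ≤ lam ^ (n₀ + 2) := exp_neg_rsep_le_rpow hr hlam h1 hn
  have hsplit : lam ^ (-a) * lam ^ (n₀ + 2) = lam ^ (1 - a) * lam ^ (n₀ + 1) := by
    rw [← Real.rpow_add hlam, ← Real.rpow_add hlam]; ring_nf
  calc K * lam ^ (-a) * Real.exp (-rsep r lam) ≤ K * lam ^ (-a) * lam ^ (n₀ + 2) :=
        mul_le_mul_of_nonneg_left hexp (mul_nonneg hK (Real.rpow_nonneg hlam.le _))
    _ = (K * lam ^ (1 - a)) * lam ^ (n₀ + 1) := by rw [mul_assoc, hsplit, ← mul_assoc]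
    _ ≤ 1 * lam ^ (n₀ + 1) := mul_le_mul_of_nonneg_right hKs (Real.rpow_nonneg hlam.le _)
    _ = lam ^ (n₀ + 1) := one_mul _

/-- **THE NEW TINY TERMS AT `⅙`** — [Dimock2013BalabanII] §3.18, verbatim: *"For the terms R_{k+1,π⁺}(X) we use 𝒪(1)
λ_{k+1}^{n₀+1}e^{−2κd_M(X)} ≤ λ_{k+1}^{n₀}e^{−κd_M(X)}"* — PROVED with the fraction the assembly needs made explicit:
`|r| ≤ C′λ^{n₀+1}e^{−2κd}`, `6C′λ ≤ 1`, `κ, d ≥ 0` ⇒ `|r| ≤ ⅙λ^{n₀}e^{−κd}` (one spare power of the coupling absorbs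
`𝒪(1)` and the `⅙`). [cite: Dimock2013BalabanII, §3.18 proof of Lemma 3.22 (arXiv:1212.5562v2 TeX L6228–6233)] -/
theorem new_tiny_sixth {r C' n₀ κ d lam : ℝ} (hlam : 0 < lam) (hκ : 0 ≤ κ) (hd : 0 ≤ d)
    (hr : |r| ≤ C' * lam ^ (n₀ + 1) * Real.exp (-(2 * κ) * d)) (hsmall : 6 * C' * lam ≤ 1) :
    |r| ≤ (1 / 6) * lam ^ n₀ * Real.exp (-κ * d) := by
  have hpow : lam ^ (n₀ + 1) = lam ^ n₀ * lam := by rw [Real.rpow_add hlam, Real.rpow_one]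
  have hexp : Real.exp (-(2 * κ) * d) ≤ Real.exp (-κ * d) := exp_rate_mono hd (by linarith)
  have hln : 0 ≤ lam ^ n₀ := Real.rpow_nonneg hlam.le _
  have h1 : C' * lam ^ (n₀ + 1) ≤ (1 / 6) * lam ^ n₀ := by
    rw [hpow]; nlinarith [mul_le_mul_of_nonneg_left hsmall hln]
  rcases le_or_gt 0 (C' * lam ^ (n₀ + 1)) with hnn | hneg
  · calc |r| ≤ C' * lam ^ (n₀ + 1) * Real.exp (-(2 * κ) * d) := hr
      _ ≤ (1 / 6) * lam ^ n₀ * Real.exp (-κ * d) := mul_le_mul h1 hexp (Real.exp_pos _).le (by positivity)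
  · have : |r| ≤ 0 := hr.trans (mul_nonpos_of_nonpos_of_nonneg hneg.le (Real.exp_pos _).le) |>.trans le_rfl
    have h0 : (0:ℝ) ≤ (1 / 6) * lam ^ n₀ * Real.exp (-κ * d) := by positivity
    linarith

/-! ## Part 3. The assembly: six sixths -/

/-- The `⅙` of L6116/L6119 is one over the number of parts of `R^*` (L6020: `R^{*,(0)} + … + R^{*,(5)}`). [folklore] -/
theorem why_one_sixth : (6 : ℝ) * (1 / 6) = 1 := by norm_num

/-- **(lulu), FIRST LINE, REPRODUCED WITHOUT A CONSTANT** — [Dimock2013BalabanII] Lemma 3.22, verbatim: *"|R_{k+1,π⁺}(X)|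
≤ λ_{k+1}^{n₀} e^{−κd_M(X)}"* — from the six printed pieces at an ARBITRARY step (`λ_{k+1} = Lλ_k`): the old piece
`|r₀| ≤ C₀L³λ_k^{n₀}e^{−L(κ−8κ₀−8)d}` (L6107) and the new pieces `|r_i| ≤ C_iλ_{k+1}^{n₀+1}e^{−2κd}` (L6224 for (1);
(2)–(5) by *"as before"* / *"treated like"*, L6252, L6257–6259 — a reading), under the `k`-FREE clauses `6C₀ ≤
L^{n₀−3}`, `κ ≤ L(κ−8κ₀−8)`, `0 ≤ κ`, `6C_iλ_{k+1} ≤ 1`.  PRECISION (v1.1): as printed, pieces (4),(5) are localized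
in δΛ_k and *"All these terms contribute to B^{*,(R)}_{k+1,π⁺}(X)"* (L6261–6270), so in the R-half `h₄, h₅` hold
vacuously with `r₄ = r₅ = 0`, `C₄ = C₅ = 0` (`R_half_as_printed`); this statement is the conservative superset.
[cite: Dimock2013BalabanII, §3.18 Lemma 3.22 (arXiv:1212.5562v2 TeX L6064–6069, L6075–6270)] -/
theorem R_reproduced {C₀ C₁ C₂ C₃ C₄ C₅ L n₀ κ κ₀ d lamk lamk1 r₀ r₁ r₂ r₃ r₄ r₅ : ℝ} (hL : 0 < L)
    (hlamk : 0 < lamk) (hstep : lamk1 = L * lamk) (hκ : 0 ≤ κ) (hd : 0 ≤ d) (hC₀ : 0 ≤ C₀)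
    (hbig : 6 * C₀ ≤ L ^ (n₀ - 3)) (hrate : κ ≤ L * (κ - 8 * κ₀ - 8))
    (h₀ : |r₀| ≤ C₀ * L ^ 3 * lamk ^ n₀ * Real.exp (-(L * (κ - 8 * κ₀ - 8)) * d))
    (h₁ : |r₁| ≤ C₁ * lamk1 ^ (n₀ + 1) * Real.exp (-(2 * κ) * d)) (hs₁ : 6 * C₁ * lamk1 ≤ 1)
    (h₂ : |r₂| ≤ C₂ * lamk1 ^ (n₀ + 1) * Real.exp (-(2 * κ) * d)) (hs₂ : 6 * C₂ * lamk1 ≤ 1)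
    (h₃ : |r₃| ≤ C₃ * lamk1 ^ (n₀ + 1) * Real.exp (-(2 * κ) * d)) (hs₃ : 6 * C₃ * lamk1 ≤ 1)
    (h₄ : |r₄| ≤ C₄ * lamk1 ^ (n₀ + 1) * Real.exp (-(2 * κ) * d)) (hs₄ : 6 * C₄ * lamk1 ≤ 1)
    (h₅ : |r₅| ≤ C₅ * lamk1 ^ (n₀ + 1) * Real.exp (-(2 * κ) * d)) (hs₅ : 6 * C₅ * lamk1 ≤ 1) :
    |r₀ + r₁ + r₂ + r₃ + r₄ + r₅| ≤ lamk1 ^ n₀ * Real.exp (-κ * d) := by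
  have hlamk1 : 0 < lamk1 := by rw [hstep]; positivity
  have e₀ := old_tiny_sixth hL hlamk hstep hd h₀ hC₀ hbig hrate
  have e₁ := new_tiny_sixth hlamk1 hκ hd h₁ hs₁
  have e₂ := new_tiny_sixth hlamk1 hκ hd h₂ hs₂
  have e₃ := new_tiny_sixth hlamk1 hκ hd h₃ hs₃
  have e₄ := new_tiny_sixth hlamk1 hκ hd h₄ hs₄
  have e₅ := new_tiny_sixth hlamk1 hκ hd h₅ hs₅
  have habs : |r₀ + r₁ + r₂ + r₃ + r₄ + r₅| ≤ |r₀| + |r₁| + |r₂| + |r₃| + |r₄| + |r₅| := by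
    have := abs_add_le (r₀ + r₁ + r₂ + r₃ + r₄) r₅; have := abs_add_le (r₀ + r₁ + r₂ + r₃) r₄
    have := abs_add_le (r₀ + r₁ + r₂) r₃; have := abs_add_le (r₀ + r₁) r₂; have := abs_add_le r₀ r₁
    linarith
  linarith

/-- **THE R-HALF AS PRINTED** (v1.1, XREAD C-adv4-125 I1) — [Dimock2013BalabanII] §3.18, L6261–6270: pieces (4),(5)
*"are initially localized in δΛ_k = Λ_k − Λ_{k+1}"* and *"All these terms contribute to B^{*,(R)}_{k+1,π⁺}(X)"*, so
the R_{k+1}(X) sum of (lulu)'s first line is carried by pieces (0)–(3) alone: `R_reproduced` with `r₄ = r₅ = 0`,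
`C₄ = C₅ = 0` (its `h₄, h₅, hs₄, hs₅` discharged trivially) gives `|r₀ + r₁ + r₂ + r₃| ≤ λ_{k+1}^{n₀}e^{−κd}` — the
`⅙` per piece is sufficient (`4·⅙ ≤ 1`), not necessary.
[cite: Dimock2013BalabanII, §3.18 proof of Lemma 3.22 (arXiv:1212.5562v2 TeX L6255–6270)] -/
theorem R_half_as_printed {C₀ C₁ C₂ C₃ L n₀ κ κ₀ d lamk lamk1 r₀ r₁ r₂ r₃ : ℝ} (hL : 0 < L)
    (hlamk : 0 < lamk) (hstep : lamk1 = L * lamk) (hκ : 0 ≤ κ) (hd : 0 ≤ d) (hC₀ : 0 ≤ C₀)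
    (hbig : 6 * C₀ ≤ L ^ (n₀ - 3)) (hrate : κ ≤ L * (κ - 8 * κ₀ - 8))
    (h₀ : |r₀| ≤ C₀ * L ^ 3 * lamk ^ n₀ * Real.exp (-(L * (κ - 8 * κ₀ - 8)) * d))
    (h₁ : |r₁| ≤ C₁ * lamk1 ^ (n₀ + 1) * Real.exp (-(2 * κ) * d)) (hs₁ : 6 * C₁ * lamk1 ≤ 1)
    (h₂ : |r₂| ≤ C₂ * lamk1 ^ (n₀ + 1) * Real.exp (-(2 * κ) * d)) (hs₂ : 6 * C₂ * lamk1 ≤ 1)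
    (h₃ : |r₃| ≤ C₃ * lamk1 ^ (n₀ + 1) * Real.exp (-(2 * κ) * d)) (hs₃ : 6 * C₃ * lamk1 ≤ 1) :
    |r₀ + r₁ + r₂ + r₃| ≤ lamk1 ^ n₀ * Real.exp (-κ * d) := by
  have hz : |(0:ℝ)| ≤ 0 * lamk1 ^ (n₀ + 1) * Real.exp (-(2 * κ) * d) := by simp
  have hsz : 6 * (0:ℝ) * lamk1 ≤ 1 := by norm_num
  have h := R_reproduced hL hlamk hstep hκ hd hC₀ hbig hrate h₀ h₁ hs₁ h₂ hs₂ h₃ hs₃ hz hsz hz hsz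
  simpa using h

/-- THE SMALLNESS IS MONOTONE: the clauses `6C_iλ_{k+1} ≤ 1` at `λ_max` imply them at every `λ_{k+1} ≤ λ_max`
(`C_i ≥ 0`), so `R_reproduced` applies at EVERY step of a run with `λ_j ≤ λ_max`. [folklore] -/
theorem small_mono {C lamMax lam : ℝ} (hC : 0 ≤ C) (hle : lam ≤ lamMax) (h : 6 * C * lamMax ≤ 1) :
    6 * C * lam ≤ 1 :=
  (mul_le_mul_of_nonneg_left hle (by positivity)).trans h

end Literature.MathematicalPhysics.QuantumFieldTheory.Dimock2011to13.TinyTermLedger
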